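import Summits.QuantumFields.YangMills.Theorems.BalabanUVNodesN26AtBetaOfRecord11B13Layers
import Literature.MathematicalPhysics.QuantumFieldTheory.Balaban1983to89.Beta.RemainderData190TowerFlat

/-!
# DAG node N26 — THE (D4)-CHAIN AT `Node00.betaOfRecord₁₁ θ` OVER NODE 00's [B13] LAYER SEQUENCES WITH NODE D's (190)-DATUM
# SUPPLIED, LETTER-FREE, BY NE9's FLAT TOWER OPERATOR `H₁,k(1)` ON THE LAYERS' OWN TORI — the junction of the row-(D4) owner's
# chain object `…N26AtBetaOfRecord11B13Layers.chainTFac190H_ofB13Layers` (p468083) with the same lineage's «Y19»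
# `Beta.RemainderData190TowerFlat.exists_data190_tower_flat` (the (190)-socket `Data190` inhabited on the bond-field carriers of
# the tower at zero background, GENERIC in the exhausting torus sequence)

Cell pub-balaban, β-function sub-cell, BINDER row (D4) OWNER lineage `b2b-balaban-beta-an4` (gen 125; memo
`HOME/b2b-balaban-beta-an4/FLAT-LETTERS-LOCATED.md` §33 (v) «WHAT REMAINS for row (D4) … NODE D (`Data190` on the layers' tori —
junction of the §§22–26 tower ENDs with these carriers)» and §36).

WHY THIS FILE.  The (D4)-chain at the record's split `chainTFac190H_ofB13Layers` (p468083; read along run sequences by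
dag-n26-c's `…N26AtRecord12B13RunLayers`, p470063) takes, per (scale `k`, history `p`), the (190)-side datum
`D k p : Beta.RemainderDecay190.Data190 4 M (NOfLayers (lam k p)) (Wn k p) q` on the tori of the layer sequence — 21 fields,
among them the ONLY estimate of [15] the wall consumes, (190) p. 308 for `(δ∕δB)𝓗(0)` (`h190`), and the p. 282 ∕ (4.35)
dictionary — as a DISPLAYED HYPOTHESIS on an arbitrary family of (4.4)-spaces `Wn k p`.  Since gen 115 the tree holds «Y19»:
for NE9's flat tower operator `H₁,k(1) = G₁,k(1)Q_k†(Q_kG₁,k(1)Q_k†)⁻¹` ([15] (129)–(130) ∕ [5] (3.126) ∕ [3] (1.103) at `U = 1`)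
the socket `Data190 d M N (fine bond fields of the (k+1)-storey tower over the unit torus of side N n·M) q` IS INHABITED for
EVERY torus sequence `N`, with NO displayed analytic letter — thresholds `(δ⋆, C⋆)` of the structure data first, then numerics
on `q` only — and with the (4.35) computation rule of its test vectors `D.hn` exposed at every admissible regularity display ∕
positivity witness of `Δ_{a,k}(1)` the consumer may hold.  The layers' tori `NOfLayers (lam k p) = m ↦ (lam k p m).n + 1` ARE
such a sequence.  This module writes that junction: §1 `exists_chainTFac190H_ofB13Layers_towerFlat` — `∃ (δ⋆, C⋆)` FIRST,
then for every choice of tower weights per scale, cube side `M`, block-geometry letters, source direction ∕ value, `q` under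
numerics, every Stage-11 tuple `θ`, box, leaf kernels with the (1.22) identification, layer sequences with the laws, N10's leaf
and the restriction sentence, and every (4.4) seam ∕ (1.7) datum stated on the TOWER CARRIERS over the layers' tori — the
test-vector limit `hconv` now read on the EXPLICIT flat vectors `b ↦ [site below b ∈ Ȳ] ? (H₁,k(1))ᵉ(δ_{(ê x, μ₀)}·w₀)(b) : 0` —
the chain `∃ R : ChainTFac190H 4 M μ ν (oneLoopSplitOfRecord₁₁ F N θ) γ₀ c (L∕2) α₂ q` with `R.A1 = A1` and the
WATCH-D4-TORUS-SEQUENCE handles (`N`, `W` by name), PLUS the rows-(D4) ∧ B4 residue `AtSlopeCont` and B4 `BetaContH` at the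
record from the same list (§1's second and third clauses).  Compared with p468083 §1 the displayed binder group
`(Wn, instW, instWs, D)` is GONE: `Wn k p m := Bond 4 (towerP L ((lam k p m).n+1)·M (k+1)) → W` (sup norm) and `D k p` is
CONSTRUCTED («Y19» at `N := NOfLayers (lam k p)`, height `k + 1` at scale index `k` = NE9's `H1k … k`); what enters instead is
PARAMETRIC — NE9's tower structure data (`L ≥ 3`, the C⋆-algebra `𝔸` with its trace `τ` and Hilbert model `W ≃ 𝔸`, `a, a′,
ρ_w, A_Q`), per-scale weights `η_k L^{k+1} = 1`, `c₀(k)(L^{k+1})⁴ = c₁(k)`, block-geometry letters, and the numerics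
`0 < q.σ`, `c₀(δr, q.σ∕δr)⁴ ≤ q.cR`, `1 ≤ q.κB`, `q.δ15 ≤ δ⋆`, `C⋆ ≤ q.Cst`, `‖w₀‖ ≤ q.m`, `q.θ ≤ 1`.

HONEST FRAMING.  Compositions BY NAME (0 `def`, 0 `sorry`; one `choose` over «Y19» per (k, p) and p468083's object); NO estimate
is proved here and nothing of Bałaban's is constructed beyond NE9's flat tower operator.  NODE D is supplied on the MODEL CLASS
of «Y19» — zero background (`□₀ = 1`, `Δ⁽²⁾(1) = 0`), the one-domain tower `Ω_k = T_η` of height `k + 1` over the layer's coarse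
torus, the VALUE line of (190) only (every local size is the value sup size), ONE unit source per unit-lattice site (direction
`μ₀`, value `w₀`); whether Bałaban's (4.35) test vectors of the record's (k+1)-st step ARE these (multi-level `{Ω_j}`, background
`U_k`, the `∇` ∕ Hölder ∕ Laplacian lines feeding the true (4.4)-norm) is the term-tower-of-record identification (def-T's
`TermTowerOfRecord`, absent) — NOT asserted.  STILL DISPLAYED: the layer SEQUENCES with `(lam k p m).n ↗` (NODE O ∕ 00), N10's leaf
+ `Restr` per layer (NODE A, 0∕1), the laws, the (4.4) seams `emb` FROM THE TOWER's FINE BOND FIELDS into the layers' spaces with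
the activities holomorphic along them (NODE B), the (1.7) ∕ (1.21) data `V, F, r, hfac, t, hconv` and the read-out `ha` (NODE E),
the (1.22) identification `hm`, (C-pt), N1–N3.  (D4) INSTANCE 0∕1, D4 DISCHARGE NO DATE; θ-keyed implications only; N25 ∕ N26 NOT
discharged; counts unmoved.  One finite four-torus programme at fixed ε per run — NOT the continuum limit, NOT ℝ⁴, NOT infinite
volume, NOT OS, NOT a mass gap, NOT Clay.  No `instance`, no `notation`, no `axiom`.
Sources (context): [I] = [Balaban1987RG1] CMP **109** (1987): (1.7) p. 261, (1.20)–(1.22) p. 264, (4.4) p. 281, p. 282, (4.35)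
p. 290, (5.10) p. 293; [II] = [Balaban1988RG2Cluster] CMP **116** (1988): (2.13) p. 14, p. 15, Lemma 3 (2.38) p. 20, p. 21;
[15] = [Balaban1985Variational] CMP **102** (1985): (129)–(130) p. 297, (190) p. 308; [5] = [Balaban1985BackgroundPropagators]
CMP **99** (1985): (3.126) p. 420, (3.133)–(3.134) p. 422, Thm 3.11 p. 416; [3] = [Balaban1984PropagatorsII] CMP **96** (1984):
(1.103) p. 36, Lemma 2.1 (2.61) p. 234.
-/

noncomputable section

open scoped Matrix.Norms.L2Operator InnerProductSpace ComplexConjugate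

namespace Summit.QuantumFields.YangMills.Theorems.BalabanUVNodesN26AtBetaOfRecord11B13LayersTowerFlat

open Literature.MathematicalPhysics.QuantumFieldTheory.Balaban1983to89
open Literature.MathematicalPhysics.QuantumFieldTheory.Balaban1983to89.FlowStep
open Literature.MathematicalPhysics.QuantumFieldTheory.Balaban1983to89.T4Continuum (T4Family)
open Literature.MathematicalPhysics.QuantumFieldTheory.Balaban1983to89.Node00
open Literature.MathematicalPhysics.QuantumFieldTheory.Balaban1983to89.B13ScaleTransfer (Pt)
open Literature.MathematicalPhysics.QuantumFieldTheory.Balaban1983to89.TreeLengthTorus (TPt TDom proj)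
open Literature.MathematicalPhysics.QuantumFieldTheory.Balaban1983to89.B4Sect5Torus (TSite)
open Literature.MathematicalPhysics.QuantumFieldTheory.Balaban1983to89.B12Decay510 (mixedDeriv)
open Literature.MathematicalPhysics.QuantumFieldTheory.Balaban1983to89.B12Decay510Torus (tcubeOf)
open Literature.MathematicalPhysics.QuantumFieldTheory.Balaban1983to89.B9SectCLatticeCarrier (Bond bpos)
open Literature.MathematicalPhysics.QuantumFieldTheory.Balaban1983to89.B9Eq311L2Pairing (WL2)
open Literature.MathematicalPhysics.QuantumFieldTheory.Balaban1983to89.B9Eq315QTower (towerP UlevOf)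
open Literature.MathematicalPhysics.QuantumFieldTheory.Balaban1983to89.B9Eq315QTorus (perCfg cornerSite)
open Literature.MathematicalPhysics.QuantumFieldTheory.Balaban1983to89.B9Eq319QprimeTorus (blockCoord)
open Literature.MathematicalPhysics.QuantumFieldTheory.Balaban1983to89.B9Eq316TowerFlatIsOneStep (siteCast towerP_eq_fineP_pow)
open Literature.MathematicalPhysics.QuantumFieldTheory.Balaban1983to89.B7Prop1Explicit (U1 Wcx boxVec)
open Literature.MathematicalPhysics.QuantumFieldTheory.Balaban1983to89.B7Prop2Explicit (c2')
open Literature.MathematicalPhysics.QuantumFieldTheory.Balaban1983to89.B11Eq103H1Complex (BondL2K)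
open Literature.MathematicalPhysics.QuantumFieldTheory.Balaban1983to89.B9Eq326OperatorTower (laplaceAk H1k)
open Literature.MathematicalPhysics.QuantumFieldTheory.Balaban1983to89.Beta.RemainderChainLattice
open Literature.MathematicalPhysics.QuantumFieldTheory.Balaban1983to89.Beta.RemainderLimitTorus (LDom limKernel tproj)
open Literature.MathematicalPhysics.QuantumFieldTheory.Balaban1983to89.Beta.RemainderDecay190 (Consts190 Data190)
open Literature.MathematicalPhysics.QuantumFieldTheory.Balaban1983to89.Beta.RemainderDecay190HoloChain (ChainTFac190H)
open Literature.MathematicalPhysics.QuantumFieldTheory.Balaban1983to89.Beta.RemainderWOfRecordB13 (SpLaw Law213 NOfLayers)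
open Literature.MathematicalPhysics.QuantumFieldTheory.Balaban1983to89.Beta.RemainderData190TowerFlat (exists_data190_tower_flat)
open Summit.QuantumFields.BalabanUV.Gaps
open Summit.QuantumFields.BalabanUV.Gaps.BetaContFromD4Chain
open Summit.QuantumFields.YangMills.Theorems.BalabanUVNodesN26AtBetaOfRecord11B13Layers
  (chainTFac190H_ofB13Layers betaContH_betaOfRecord₁₁_of_b13Layers atSlopeCont_oneLoopSplitOfRecord₁₁_of_b13Layers)
open Metric Filter Topology

variable (F : T4Family) (N : ℕ) [NeZero N]

/-! ## §1 The chain at the record with NODE D's datum := NE9's flat tower operator on the layers' tori («Y19» at `N := NOfLayers (lam k p)`) -/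

section TowerFlat

-- NE9's tower structure data ([5] §3 ∕ [15]: block size `L ≥ 3`, the C⋆-algebra `𝔸`, its Hilbert model `W ≃ 𝔸`, the trace `τ`, `a, a′, ρ_w, A_Q`)
variable (L : ℕ) [NeZero L] (hL : 1 ≤ L) (hL3 : 3 ≤ L)
  {𝔸 : Type*} [CStarAlgebra 𝔸] [Nontrivial 𝔸]
  {W : Type} [NormedAddCommGroup W] [InnerProductSpace ℂ W] [FiniteDimensional ℂ W] (φ : W ≃ₗ[ℂ] 𝔸)
  {Mφ Mφ' : ℝ} (hMφ : 0 ≤ Mφ) (hMφ' : 0 ≤ Mφ') (hφ : ∀ w, ‖φ w‖ ≤ Mφ * ‖w‖) (hφ' : ∀ X, ‖φ.symm X‖ ≤ Mφ' * ‖X‖)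
  {a₁ : ℝ} (ha₁ : 0 < a₁) {a₁' : ℝ} (ha₁' : 0 < a₁')
  (τ : 𝔸 →ₗ[ℂ] ℂ) {Cτ : ℝ} (hτ : ∀ X, ‖τ X‖ ≤ Cτ * ‖X‖) (hCτ : 0 ≤ Cτ) {Mτ : ℝ}
  (hτm : ∀ X Y : 𝔸, ‖τ (X * Y)‖ ≤ Mτ * ‖X‖ * ‖Y‖) (hMτ : 0 ≤ Mτ) {ρw : ℝ} (hρw : 0 ≤ ρw)
  (hτ₁ : ∀ X : 𝔸, τ (star X) = conj (τ X)) (hτ₂ : ∀ X Y : 𝔸, τ (X * Y) = τ (Y * X))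
  (hφτ : ∀ X Y : 𝔸, ⟪φ.symm X, φ.symm Y⟫_ℂ = τ (star X * Y))
  (AQ : ℝ) (hAQ16 : 16 * (((4 : ℕ) : ℝ) + 1) * (((4 : ℕ) : ℝ) + 4) * c2' 4 L ≤ AQ)

include hL3 hMφ hMφ' hφ hφ' ha₁ ha₁' hτ hCτ hτm hMτ hρw hτ₁ hτ₂ hφτ hAQ16

/-- **THE (D4)-CHAIN AT THE RECORD'S SPLIT OVER NODE 00's [B13] LAYER SEQUENCES WITH NODE D's (190)-DATUM SUPPLIED BY NE9's FLAT
TOWER OPERATOR ON THE LAYERS' OWN TORI** («Y19» `exists_data190_tower_flat` at `N := NOfLayers (lam k p)` plugged into p468083's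
`chainTFac190H_ofB13Layers`).  `∃ (δ⋆, C⋆)` FIRST (functions of NE9's structure data only); then for every family of tower weights per
scale (`η_k L^{k+1} = 1`, `c₀(k) (L^{k+1})⁴ = c₁(k)`, `|η_k|⁴∕c₀(k) ≤ ρ_w`), cube side `M`, size index set `I ∋ i₀`, block-torus geometry
letters, source direction `μ₀` and value `w₀`, every `q : Consts190` under NUMERICS ONLY (`0 < q.σ`, `c₀(δr, q.σ∕δr)⁴ ≤ q.cR`,
`1 ≤ q.κB`, `q.δ15 ≤ δ⋆`, `C⋆ ≤ q.Cst`, `‖w₀‖ ≤ q.m`, `q.θ ≤ 1`), every Stage-11 tuple `θ` with a box `γ₀ ≤ θ.γ`, leaf kernels `A1`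
with the (1.22) identification in the record's letters, PER (k, p) a (1.21) sequence of residual layers `lam k p` with `(lam k p m).n ↗`
at common constants of record, the laws `SpLaw` ∕ `Law213`, N10's [B13] leaf + `Restr` on every layer, N1 (`CondsL 4 c (L∕2)`) and
the signs, ANY admissible regularity display `(αU, hα1, hαL, hU1, hreg)` and positivity witness `hpos` of `Δ_{a,k}(1)` per (k, p, m)
(«Y19» §1 derives one; the operator does not depend on the choice, «Y12c»), and every (4.4) seam `emb k p m X` FROM THE FINE BOND
FIELDS OF THE (k+1)-STOREY TOWER OVER THE UNIT TORUS OF SIDE `((lam k p m).n+1)·M` into `(lam k p m).sp2 X` with the layers'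
activities holomorphic along it, (1.7) data `V, F, r, hfac, t` with the test-vector limit `hconv` READ ON THE EXPLICIT FLAT VECTORS
`b ↦ [unit-lattice site below b ∈ a cube of Ȳ] ? (H₁,k(1))ᵉ(δ_{(ê x, μ₀)}·w₀)(b) : 0` and the read-out `ha`:
(i) `∃ R : ChainTFac190H 4 M μ ν (oneLoopSplitOfRecord₁₁ F N θ) γ₀ c (L∕2) α₂ q` with `R.A1 = A1`, `(R.leaves k p hp).N = m ↦ (lam k p m).n + 1`
and `(R.leaves k p hp).W ≍ m ↦ (WtOfRecord θ₃ (lam k p m)).toTorusStep` (dag-ref-D's WATCH-D4-TORUS-SEQUENCE handles; the steps handle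
is `HEq` because the tori of an `∃`-bound chain are a field — the `N` handle is the index equation that makes it an `Eq`), and the
(4.4)-spaces handle `(R.leaves k p hp).Wn = m ↦ (Bond 4 (towerP L ((lam k p m).n+1)·M (k+1)) → W)` (NODE D's carriers ARE the tower's fine bond fields);
(ii) with N2–N3 (`R22gen (L∕2)`, `Valid`), smallness `ε₁·K_rem,L ≤ s` and (C-pt) on `A1`: `AtSlopeCont (oneLoopSplitOfRecord₁₁ F N θ) γ₀ s`;
(iii) with N2–N3 and (C-pt): `BetaContH γ₀ (betaOfRecord₁₁ F N θ)`.  NODE D on «Y19»'s MODEL class (zero background, one-domain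
tower, value line, one source direction); every other input displayed; instance 0∕1.
[cite: Balaban1985Variational, (129)–(130) p.297, (190) p.308] [cite: Balaban1985BackgroundPropagators, (3.126) p.420, (3.133)–(3.134) p.422, Thm 3.11 p.416]
[cite: Balaban1984PropagatorsII, (1.103) p.36, Lemma 2.1 (2.61) p.234] [cite: Balaban1987RG1, (1.7) p.261, (1.20)-(1.22) p.264, (4.4) p.281, p.282, (4.35) p.290, (5.10) p.293]
[cite: Balaban1988RG2Cluster, (2.13) p.14, p.15, Lemma 3 (2.38) p.20 and p.21] -/
theorem exists_chainTFac190H_ofB13Layers_towerFlat :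
    ∃ δs Cs : ℝ, 0 < δs ∧ 0 ≤ Cs ∧
      ∀ -- tower weights per scale `k` (height `k + 1`)
        (η : ℕ → ℝ) (_hηL : ∀ k, η k * (L : ℝ) ^ (k + 1) = 1) (c₀ c₁ : ℕ → ℝ) [∀ k, Fact (0 < c₀ k)] [∀ k, Fact (0 < c₁ k)]
        (_hw : ∀ k, c₀ k * ((L : ℝ) ^ (k + 1)) ^ 4 = c₁ k) (_hρ : ∀ k, |η k| ^ 4 / c₀ k ≤ ρw)
        -- cube side, size indices, block-geometry letters, source direction ∕ value, the (190)-record under numerics only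
        (M : ℕ) [NeZero M] (I : Type) (_i₀ : I) (η₀ L₀ M₀ Rg : ℕ → ℝ) (Hg : ℕ → Prop) (μ₀ : Fin 4) (w₀ : W)
        (q : Consts190) (δr : ℝ) (_hδr : 0 < δr) (_hσ₀ : 0 < q.σ) (_hcR : B6.c0 δr (q.σ / δr) ^ 4 ≤ q.cR) (_hκB : 1 ≤ q.κB)
        (_hδ15 : q.δ15 ≤ δs) (_hCst : Cs ≤ q.Cst) (_hmw : ‖w₀‖ ≤ q.m) (_hθ1 : q.θ ≤ 1)
        -- the record, the box, the leaf kernels with the (1.22) identification in the record's letters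
        (γ₀ : ℝ) (μ ν : Fin 4) (c : B13.Consts) (α₂ : ℝ) (θ : Stage11Params F N) (_hle : γ₀ ≤ θ.γ)
        (A1 : (k : ℕ) → (Fin (k + 1) → ℝ) → LDom 4 → Pt 4 → ℝ)
        (_hm : ∀ k (p : Fin (k + 1) → ℝ), p ∈ Box γ₀ k →
          betaMergedOfRecord₁₁ F N θ k p =
            beta0OfRecord₁₁ F N θ k + B12Beta.secondMoment (fun _ _ => limKernel (A1 k p)) μ ν)
        -- per (scale, history): a (1.21) SEQUENCE of NODE 00's residual layers with growing coarse tori at common constants; laws, N10's leaf, `Restr`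
        (lam : (k : ℕ) → (Fin (k + 1) → ℝ) → ℕ → ResidB13 θ.toStage3Params)
        (_hn : ∀ k p, Tendsto (fun m => (lam k p m).n) atTop atTop)
        (_hc : ∀ k p m, c13OfRecord θ.toStage3Params (lam k p m) = c)
        (_hsp : ∀ k p m, SpLaw (lam k p m)) (_h213 : ∀ k p m, Law213 (lam k p m))
        (_hleaf : ∀ k p m, B13LeafOfRecord θ.toStage3Params (lam k p m)) (_hR : ∀ k p m, (lam k p m).Restr)
        (_hC : CondsL 4 c ((c.L : ℝ) / 2)) (_hs : SignsL c α₂ q.B₃)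
        -- ANY admissible regularity display and positivity witness of `Δ_{a,k}(1)` per (k, p, m) on the tower over the layer's torus
        (αU : (k : ℕ) → (Fin (k + 1) → ℝ) → ℕ → ℕ → ℝ) (hα1 : ∀ k p m j, αU k p m j ≤ 1 / 64)
        (hαL : ∀ k p m j, 50 * (((4 : ℕ) : ℝ) + 1) * αU k p m j * (L : ℝ) ^ 4 ≤ 1 / 2)
        (hU1 : ∀ k p m (j : ℕ) (z : B7Prop1Explicit.Site 4) (κ : Fin 4),
          perCfg (towerP L (fun _ : Fin 4 => NOfLayers (lam k p) m * M) (j + 1))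
            (UlevOf L (fun _ : Fin 4 => NOfLayers (lam k p) m * M) (k + 1) (fun _ => (1 : 𝔸ˣ)) j) z κ ∈ U1 𝔸)
        (hreg : ∀ k p m (j : ℕ) (y : TSite 4 (towerP L (fun _ : Fin 4 => NOfLayers (lam k p) m * M) j)) (κ : Fin 4)
          (ρ' : Fin 4 → Fin L),
          ‖((Wcx L (perCfg (towerP L (fun _ : Fin 4 => NOfLayers (lam k p) m * M) (j + 1))
              (UlevOf L (fun _ : Fin 4 => NOfLayers (lam k p) m * M) (k + 1) (fun _ => (1 : 𝔸ˣ)) j))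
              (cornerSite L y) κ (boxVec L ρ') : 𝔸ˣ) : 𝔸) - 1‖ ≤ αU k p m j)
        (hpos : ∀ k p m (v : BondL2K ℂ 4 (towerP L (fun _ : Fin 4 => NOfLayers (lam k p) m * M) (k + 1)) (c₀ k) W), v ≠ 0 →
          0 < RCLike.re ⟪v, laplaceAk L (fun _ : Fin 4 => NOfLayers (lam k p) m * M) k φ (η k) (fun _ => (1 : 𝔸ˣ)) hL
            (αU k p m) (hα1 k p m) (hU1 k p m) (hreg k p m) τ (c₀ := c₀ k) (c₁ := c₁ k) a₁ v⟫_ℂ)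
        -- the (4.4) seams FROM THE TOWER's FINE BOND FIELDS into the layers' spaces p. 15, the layers' ACTIVITIES holomorphic along them
        (emb : (k : ℕ) → (p : Fin (k + 1) → ℝ) → (m : ℕ) → TDom 4 ((lam k p m).n + 1) →
          (Bond 4 (towerP L (fun _ : Fin 4 => NOfLayers (lam k p) m * M) (k + 1)) → W) → (lam k p m).Φ)
        (_hemb : ∀ k p m X, ∀ u ∈ ball (0 : Bond 4 (towerP L (fun _ : Fin 4 => NOfLayers (lam k p) m * M) (k + 1)) → W) α₂,
          emb k p m X u ∈ (lam k p m).sp2 X)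
        (_hH : ∀ k p m (X Z : TDom 4 ((lam k p m).n + 1)), Z.1 ⊆ X.1 →
          DifferentiableOn ℂ (fun u => (lam k p m).H Z (emb k p m X u)) (ball 0 α₂))
        -- the (1.7) ∕ test-vector-limit data, the limit READ ON THE EXPLICIT FLAT TEST VECTORS, and the read-out of the leaf kernels
        (V : (k : ℕ) → (Fin (k + 1) → ℝ) → LDom 4 → Type) (_instV : ∀ k p Y, NormedAddCommGroup (V k p Y))
        (_instVs : ∀ k p Y, NormedSpace ℂ (V k p Y))
        (Fw : (k : ℕ) → (p : Fin (k + 1) → ℝ) → (Y : LDom 4) → V k p Y → ℂ)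
        (_hFd : ∀ k p Y, ∃ ρ > 0, DifferentiableOn ℂ (Fw k p Y) (ball 0 ρ))
        (r : (k : ℕ) → (p : Fin (k + 1) → ℝ) → (m : ℕ) → (Y : LDom 4) →
          (Bond 4 (towerP L (fun _ : Fin 4 => NOfLayers (lam k p) m * M) (k + 1)) → W) →L[ℂ] V k p Y)
        (_hfac : ∀ k p (Y : LDom 4), ∀ᶠ m in atTop,
          ∀ u ∈ ball (0 : Bond 4 (towerP L (fun _ : Fin 4 => NOfLayers (lam k p) m * M) (k + 1)) → W) α₂,
            (lam k p m).Ek1 (tproj ((lam k p m).n + 1) Y) (emb k p m (tproj ((lam k p m).n + 1) Y) u) = Fw k p Y (r k p m Y u))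
        (t : (k : ℕ) → (p : Fin (k + 1) → ℝ) → (Y : LDom 4) → Pt 4 → V k p Y)
        (_hconv : ∀ k p (Y : LDom 4) (x : Pt 4),
          Tendsto (fun m => r k p m Y
            (fun b : Bond 4 (towerP L (fun _ : Fin 4 => NOfLayers (lam k p) m * M) (k + 1)) =>
              if tcubeOf (NOfLayers (lam k p) m) M (fun i => ((blockCoord (L ^ (k + 1)) (fun _ : Fin 4 => NOfLayers (lam k p) m * M)
                    (siteCast (towerP_eq_fineP_pow L (fun _ : Fin 4 => NOfLayers (lam k p) m * M) (k + 1)) (bpos b)) i : ℕ) :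
                      ZMod (NOfLayers (lam k p) m * M))) ∈ (tproj ((lam k p m).n + 1) Y).1 then
                ((WL2.linearEquiv ℂ ℂ (fun _ : Bond 4 (towerP L (fun _ : Fin 4 => NOfLayers (lam k p) m * M) (k + 1)) => c₀ k) :
                    BondL2K ℂ 4 (towerP L (fun _ : Fin 4 => NOfLayers (lam k p) m * M) (k + 1)) (c₀ k) W ≃ₗ[ℂ]
                      (Bond 4 (towerP L (fun _ : Fin 4 => NOfLayers (lam k p) m * M) (k + 1)) → W))
                  (H1k L (fun _ : Fin 4 => NOfLayers (lam k p) m * M) k φ (η k) (fun _ => (1 : 𝔸ˣ)) hL (αU k p m) (hα1 k p m)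
                    (hU1 k p m) (hreg k p m) τ (c₀ := c₀ k) (c₁ := c₁ k) (hαL k p m) (hpos k p m)
                    ((WL2.linearEquiv ℂ ℂ (fun _ : Bond 4 (fun _ : Fin 4 => NOfLayers (lam k p) m * M) => c₁ k) :
                        BondL2K ℂ 4 (fun _ : Fin 4 => NOfLayers (lam k p) m * M) (c₁ k) W ≃ₗ[ℂ]
                          (Bond 4 (fun _ : Fin 4 => NOfLayers (lam k p) m * M) → W)).symm
                      (Pi.single ((fun i => (⟨((proj (((lam k p m).n + 1) * M) x) i).val,
                          ZMod.val_lt ((proj (((lam k p m).n + 1) * M) x) i)⟩ : Fin (NOfLayers (lam k p) m * M))), μ₀) w₀)))) b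
              else 0)) atTop (𝓝 (t k p Y x)))
        (_ha : ∀ k p (Y : LDom 4) (z : Pt 4), A1 k p Y z = (mixedDeriv (Fw k p Y) (t k p Y 0) (t k p Y z)).re),
      (∃ R : ChainTFac190H 4 M μ ν (oneLoopSplitOfRecord₁₁ F N θ) γ₀ c ((c.L : ℝ) / 2) α₂ q,
          R.A1 = A1 ∧
            (∀ k (p : Fin (k + 1) → ℝ) (hp : p ∈ B12Beta.HistBox γ₀ k), (R.leaves k p hp).N = fun m => (lam k p m).n + 1) ∧
            (∀ k (p : Fin (k + 1) → ℝ) (hp : p ∈ B12Beta.HistBox γ₀ k),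
              HEq (R.leaves k p hp).W (fun m => (WtOfRecord θ.toStage3Params (lam k p m)).toTorusStep)) ∧
            ∀ k (p : Fin (k + 1) → ℝ) (hp : p ∈ B12Beta.HistBox γ₀ k),
              (R.leaves k p hp).Wn = fun m => Bond 4 (towerP L (fun _ : Fin 4 => NOfLayers (lam k p) m * M) (k + 1)) → W) ∧
        (∀ (_h22 : c.R22gen ((c.L : ℝ) / 2)) (_hq : q.Valid c.δ₀) (s : ℝ) (_hsmall : c.ε₁ * remCoeffL 4 M c α₂ q.B₃ ≤ s)
          (_hcpt : ∀ k (x : Pt 4), ContinuousOn (fun p : Fin (k + 1) → ℝ => limKernel (A1 k p) x) (Box γ₀ k)),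
          AtSlopeCont (oneLoopSplitOfRecord₁₁ F N θ) γ₀ s) ∧
        (∀ (_h22 : c.R22gen ((c.L : ℝ) / 2)) (_hq : q.Valid c.δ₀)
          (_hcpt : ∀ k (x : Pt 4), ContinuousOn (fun p : Fin (k + 1) → ℝ => limKernel (A1 k p) x) (Box γ₀ k)),
          BetaContH γ₀ (betaOfRecord₁₁ F N θ)) := by
  -- «Y19»: the thresholds of NE9's structure data, and per (height, volume sequence) the datum with its (4.35) computation rule
  obtain ⟨δs, Cs, hδs, hCs, HY⟩ :=
    exists_data190_tower_flat (d := 4) (by norm_num) L hL hL3 φ hMφ hMφ' hφ hφ' ha₁ ha₁' τ hτ hCτ hτm hMτ hρw hτ₁ hτ₂ hφτ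
      AQ hAQ16
  refine ⟨δs, Cs, hδs, hCs, ?_⟩
  intro η hηL c₀ c₁ _ _ hw hρ M _ I i₀ η₀ L₀ M₀ Rg Hg μ₀ w₀ q δr hδr hσ₀ hcR hκB hδ15 hCst hmw hθ1 γ₀ μ ν c α₂ θ hle A1 hm lam hn
    hc hsp h213 hleaf hR hC hs αU hα1 hαL hU1 hreg hpos emb hemb hH V instV instVs Fw hFd r hfac t hconv ha
  -- NODE D per (k, p): «Y19» at height `k` on the layers' tori `NOfLayers (lam k p)`
  choose D hD using fun (k : ℕ) (p : Fin (k + 1) → ℝ) =>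
    HY k (η k) (hηL k) (c₀ k) (c₁ k) (hw k) (hρ k) M (NOfLayers (lam k p)) I i₀ η₀ L₀ M₀ Rg Hg μ₀ w₀ q δr hδr hσ₀ hcR hκB
      hδ15 hCst hmw hθ1
  -- the consumer's test-vector limit, transported from the explicit flat vectors to `(D k p).hn` by the computation rule
  have hconv' : ∀ k (p : Fin (k + 1) → ℝ) (Y : LDom 4) (x : Pt 4),
      Tendsto (fun m => r k p m Y ((D k p).hn m (tproj ((lam k p m).n + 1) Y) (proj (((lam k p m).n + 1) * M) x)))
        atTop (𝓝 (t k p Y x)) := fun k p Y x =>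
    (hconv k p Y x).congr fun m => by
      rw [hD k p m (tproj ((lam k p m).n + 1) Y) (proj (((lam k p m).n + 1) * M) x) (αU k p m) (hα1 k p m) (hαL k p m)
        (hU1 k p m) (hreg k p m) (hpos k p m)]
  refine ⟨⟨chainTFac190H_ofB13Layers F N θ hle A1 hm lam hn hc hsp h213 hleaf hR hC hs
      (fun k p m => Bond 4 (towerP L (fun _ : Fin 4 => NOfLayers (lam k p) m * M) (k + 1)) → W) (fun _ _ _ => inferInstance)
      (fun _ _ _ => inferInstance) emb hemb hH D V instV instVs Fw hFd r hfac t hconv' ha, rfl, fun _ _ _ => rfl,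
      fun _ _ _ => HEq.rfl, fun _ _ _ => rfl⟩, fun h22 hq s hsmall hcpt => ?_, fun h22 hq hcpt => ?_⟩
  · exact atSlopeCont_oneLoopSplitOfRecord₁₁_of_b13Layers F N θ hle A1 hm lam hn hc hsp h213 hleaf hR hC hs
      (fun k p m => Bond 4 (towerP L (fun _ : Fin 4 => NOfLayers (lam k p) m * M) (k + 1)) → W) (fun _ _ _ => inferInstance)
      (fun _ _ _ => inferInstance) emb hemb hH D V instV instVs Fw hFd r hfac t hconv' ha h22 hq hsmall hcpt
  · exact betaContH_betaOfRecord₁₁_of_b13Layers F N θ hle A1 hm lam hn hc hsp h213 hleaf hR hC hs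
      (fun k p m => Bond 4 (towerP L (fun _ : Fin 4 => NOfLayers (lam k p) m * M) (k + 1)) → W) (fun _ _ _ => inferInstance)
      (fun _ _ _ => inferInstance) emb hemb hH D V instV instVs Fw hFd r hfac t hconv' ha h22 hq hcpt

end TowerFlat

end Summit.QuantumFields.YangMills.Theorems.BalabanUVNodesN26AtBetaOfRecord11B13LayersTowerFlat

end
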